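import Mathlib
import Summits.ValiantsHypothesis.ValiantsHypothesis.Theorems.LacunarySymmetroidMatrixDescartesGramDualRank
import Summits.ValiantsHypothesis.ValiantsHypothesis.Theorems.LacunarySymmetroidMatrixDescartesGramDualCoherent
import Summits.ValiantsHypothesis.ValiantsHypothesis.Theorems.LacunarySymmetroidMatrixDescartesGramDualOrthogonalLetters
import Summits.ValiantsHypothesis.ValiantsHypothesis.Theorems.LacunarySymmetroidMatrixDescartesStubNegRoots
import Summits.ValiantsHypothesis.ValiantsHypothesis.Theorems.LacunarySymmetroidMatrixDescartesCensusFatSectors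

/-!
# `MatrixDescartes` (stmt-ValiantsHypothesis-18050) — Gram duality, part 18: the GRAM-RANK SECTOR — the intrinsic Gram
# rank (block Gram matrix of the raw letter columns), its reflection invariance, all real zeros through the effective
# format, and the crux inequality whenever the Gram rank is `O(K)`, AT EVERY SIZE

HONEST FRAMING.  Cell `pub-symmetroid`, seat `val-sym-mdr-p2` (gen 20); helper file `--supports` the crux
`Theses.LacunarySymmetroid.MatrixDescartes` (OPEN), NO closure claim; companion of `…GramDualRank` («Gram rank is the
size»: `Z₊ + 1 ≤ C(r + K − 1, r)`, `r` = rank of the `S_{l₀}⁻¹`-Gram matrix of the eigen-columns).  A SECTOR law of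
Descartes type; nothing here bears on the crux in its window, `stub_twoSided`, `DoorA26` / `DoorA34`, registers, or
`VP ≠ VNP`.

* `blockGram` reading (no eigenvectors): with `W` the `m × ((K−1)·m)` matrix of ALL columns of the letters `l ≠ l₀`
  (`W_{a,(l,j)} = (S_l)_{a j}`), the BLOCK GRAM MATRIX `𝒢 = Wᵀ S_{l₀}⁻¹ W = [S_k S_{l₀}⁻¹ S_l]_{k,l ≠ l₀}` has the SAME RANK as
  the eigen-column Gram matrix `𝔾` of `…GramDualRank` (`rank_gram_eq_rank_blockGram`: `𝕌 = W·M` and `W = 𝕌·N` by the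
  spectral theorem letter by letter), so the effective size is INTRINSIC:
  `r = rank [S_k S_{l₀}⁻¹ S_l]_{k,l≠l₀} = dim V − dim (V ∩ V^{⊥})`, `V = Σ_{l≠l₀} range S_l`, `⊥` for the form `S_{l₀}⁻¹`.
* `rank_blockGram_reflect`: the reflection `S_l ↦ (−1)^{d_l} S_l` (`X ↦ −X`) keeps `r` (it multiplies `W` by an
  invertible diagonal sign matrix and `S_{l₀}⁻¹` by a sign).
* `card_roots_pencil_le_of_gramRank_le` (ALL REAL ZEROS): `Z + 1 ≤ 2·C(r + K − 1, r)` at every size `m` (tree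
  `stub_negRoots`: positive zeros of the pencil and of its reflection, plus the origin).
* **`gramRank_mdr` (THE CRUX INEQUALITY ON THE GRAM-RANK SECTOR).**  For all `q, K ≥ 1`, EVERY size `m` (no
  quasi-polynomial bound needed), all exponents, all real symmetric letters with a non-degenerate `S_{l₀}` and Gram rank
  `≤ r` where `(12(r + K))^q ≤ K^{q+1}`: `Z^q ≤ 2^{K⌊log₂K⌋}` (the tree's `Census.descartesSector_arith` at the effective
  format).  `gramRank_linear_mdr`: Gram rank `≤ a·K` ⇒ the inequality for all `K ≥ max 1 (12(a+1))^q` — the quantifier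
  shape of `MatrixDescartes` on the format family «one non-degenerate letter, Gram rank `O(K)`, any size», which contains
  the tree's bounded/joint-rank families around a non-degenerate pivot and is strictly larger (isotropic directions of
  the joint range are free).  It says nothing about pencils of unrestricted Gram rank, where the crux lives.

[folklore] (spectral theorem + Sylvester + Descartes).  Axioms `propext`, `Classical.choice`, `Quot.sound`.
-/

-- layout Summits/ValiantsHypothesis/ValiantsHypothesis forces the duplicated namespace component
set_option linter.dupNamespace false

namespace Summit.ValiantsHypothesis.ValiantsHypothesis.Theorems.LacunarySymmetroidMatrixDescartes

open Polynomial Matrix Finset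
open scoped BigOperators

namespace GramDual

section RankMDR

variable {K m : ℕ} (d : Fin K → ℕ) (S : Fin K → Matrix (Fin m) (Fin m) ℝ) (hS : ∀ l, (S l).IsHermitian) (l₀ : Fin K)

/-- the column type: non-zero eigen-columns `(l, i)` of the letters `l ≠ l₀` (file-local notation, as in part 17) -/
local notation3 (prettyPrint := false) "𝕋" =>
  {li : Fin K × Fin m // li.1 ≠ l₀ ∧ (hS li.1).eigenvalues li.2 ≠ 0}

/-- the eigen-column matrix `U` (file-local notation, as in part 17) -/
local notation3 (prettyPrint := false) "𝕌" =>
  (Matrix.of fun (a : Fin m) (t : 𝕋) => ((hS t.1.1).eigenvectorUnitary : Matrix (Fin m) (Fin m) ℝ) a t.1.2)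

/-- the Gram matrix of the eigen-columns (file-local notation, as in part 17) -/
local notation3 (prettyPrint := false) "𝔾" => ((𝕌)ᵀ * (S l₀)⁻¹ * (𝕌))

/-- the RAW COLUMN MATRIX `W`: column `(l, j)` is column `j` of `S_l`, `l ≠ l₀` (file-local notation) -/
local notation3 (prettyPrint := false) "𝕎[" S ", " l₀ "]" =>
  (Matrix.of fun (a : Fin _) (p : {l : Fin _ // l ≠ l₀} × Fin _) => (S : Fin _ → Matrix (Fin _) (Fin _) ℝ) p.1.1 a p.2)

/-- the BLOCK GRAM MATRIX `𝒢 = Wᵀ S_{l₀}⁻¹ W = [S_k S_{l₀}⁻¹ S_l]_{k,l≠l₀}` (file-local notation) -/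
local notation3 (prettyPrint := false) "𝒢[" S ", " l₀ "]" =>
  ((𝕎[S, l₀])ᵀ * ((S : Fin _ → Matrix (Fin _) (Fin _) ℝ) l₀)⁻¹ * 𝕎[S, l₀])

/-! ## §1  The eigen-column Gram matrix and the block Gram matrix have the same rank -/

/-- `𝕌 = W · M` with `M_{(l',j),(l,i)} = [l' = l]·p_{l,i}(j)/λ_{l,i}` (each non-zero eigen-column is `S_l(p/λ)`). [folklore] -/
theorem eigenCols_eq_blockCols_mul :
    (𝕌) = 𝕎[S, l₀] * Matrix.of (fun (p : {l : Fin K // l ≠ l₀} × Fin m) (t : 𝕋) =>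
      if p.1.1 = t.1.1 then ⇑((hS t.1.1).eigenvectorBasis t.1.2) p.2 / (hS t.1.1).eigenvalues t.1.2 else 0) := by
  classical
  refine Matrix.ext fun a t => ?_
  rw [Matrix.mul_apply, Matrix.of_apply, Matrix.IsHermitian.eigenvectorUnitary_apply]
  -- the sum over pairs `(l', j)` reduces to `l' = l_t`
  rw [Fintype.sum_prod_type]
  rw [Finset.sum_eq_single (⟨t.1.1, t.2.1⟩ : {l : Fin K // l ≠ l₀})]
  · simp only [Matrix.of_apply, ↓reduceIte]
    have h := congrFun ((hS t.1.1).mulVec_eigenvectorBasis t.1.2) a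
    simp only [Matrix.mulVec, dotProduct, Pi.smul_apply, smul_eq_mul] at h
    have hcalc : ∑ j, S t.1.1 a j * (⇑((hS t.1.1).eigenvectorBasis t.1.2) j / (hS t.1.1).eigenvalues t.1.2)
        = (∑ j, S t.1.1 a j * ⇑((hS t.1.1).eigenvectorBasis t.1.2) j) / (hS t.1.1).eigenvalues t.1.2 := by
      rw [Finset.sum_div]
      refine Finset.sum_congr rfl fun j _ => ?_
      ring
    rw [hcalc, h, mul_div_cancel_left₀ _ t.2.2]
  · intro l' _ hl'
    refine Finset.sum_eq_zero fun j _ => ?_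
    simp only [Matrix.of_apply]
    rw [if_neg (fun h => hl' (Subtype.ext h)), mul_zero]
  · intro h
    exact absurd (Finset.mem_univ _) h

/-- `W = 𝕌 · N` with `N_{(l,i),(l',j)} = [l = l']·λ_{l,i}·p_{l,i}(j)` (spectral theorem letter by letter; zero eigenvalues
drop out). [folklore] -/
theorem blockCols_eq_eigenCols_mul :
    𝕎[S, l₀] = (𝕌) * Matrix.of (fun (t : 𝕋) (p : {l : Fin K // l ≠ l₀} × Fin m) =>
      if t.1.1 = p.1.1 then (hS t.1.1).eigenvalues t.1.2 * ⇑((hS t.1.1).eigenvectorBasis t.1.2) p.2 else 0) := by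
  classical
  refine Matrix.ext fun a p => ?_
  rw [Matrix.mul_apply, Matrix.of_apply, letter_apply_eq_sum S hS p.1.1 a p.2]
  simp only [Matrix.of_apply, Matrix.IsHermitian.eigenvectorUnitary_apply]
  -- the summand as a function of the pair `(l, i)`
  set g : Fin K × Fin m → ℝ := fun li => ⇑((hS li.1).eigenvectorBasis li.2) a *
      (if li.1 = p.1.1 then (hS li.1).eigenvalues li.2 * ⇑((hS li.1).eigenvectorBasis li.2) p.2 else 0) with hg
  -- right side: subtype sum → filtered sum over pairs → pairs with first component `p.1`
  have hR : (∑ t : 𝕋, ⇑((hS t.1.1).eigenvectorBasis t.1.2) a *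
        (if t.1.1 = p.1.1 then (hS t.1.1).eigenvalues t.1.2 * ⇑((hS t.1.1).eigenvectorBasis t.1.2) p.2 else 0))
      = ∑ li ∈ Finset.univ.filter (fun li : Fin K × Fin m => li.1 ≠ l₀ ∧ (hS li.1).eigenvalues li.2 ≠ 0), g li := by
    rw [Finset.sum_subtype (Finset.univ.filter (fun li : Fin K × Fin m => li.1 ≠ l₀ ∧ (hS li.1).eigenvalues li.2 ≠ 0))
        (p := fun li : Fin K × Fin m => li.1 ≠ l₀ ∧ (hS li.1).eigenvalues li.2 ≠ 0)
        (fun li => by simp only [Finset.mem_filter, Finset.mem_univ, true_and]) g]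
  have hR' : (∑ li ∈ Finset.univ.filter (fun li : Fin K × Fin m => li.1 ≠ l₀ ∧ (hS li.1).eigenvalues li.2 ≠ 0), g li)
      = ∑ li ∈ (Finset.univ.filter (fun li : Fin K × Fin m => li.1 ≠ l₀ ∧ (hS li.1).eigenvalues li.2 ≠ 0)).filter
          (fun li : Fin K × Fin m => li.1 = p.1.1), g li :=
    (Finset.sum_filter_of_ne fun li _ hne => by
      by_contra h
      apply hne
      simp only [hg]
      rw [if_neg h, mul_zero]).symm
  -- left side: drop the zero eigenvalues
  have hL : (∑ i, ⇑((hS p.1.1).eigenvectorBasis i) a * (hS p.1.1).eigenvalues i * ⇑((hS p.1.1).eigenvectorBasis i) p.2)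
      = ∑ i ∈ Finset.univ.filter (fun i : Fin m => (hS p.1.1).eigenvalues i ≠ 0),
          ⇑((hS p.1.1).eigenvectorBasis i) a * (hS p.1.1).eigenvalues i * ⇑((hS p.1.1).eigenvectorBasis i) p.2 :=
    (Finset.sum_filter_of_ne fun i _ hne => by
      intro h
      apply hne
      rw [h, mul_zero, zero_mul]).symm
  -- the two index sets correspond under `i ↦ (p.1, i)`
  have hset : (Finset.univ.filter (fun li : Fin K × Fin m => li.1 ≠ l₀ ∧ (hS li.1).eigenvalues li.2 ≠ 0)).filter
        (fun li : Fin K × Fin m => li.1 = p.1.1)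
      = (Finset.univ.filter (fun i : Fin m => (hS p.1.1).eigenvalues i ≠ 0)).map
          ⟨fun i => (p.1.1, i), fun i j h => by simpa using h⟩ := by
    ext ⟨l, i⟩
    simp only [Finset.mem_filter, Finset.mem_univ, true_and, Finset.mem_map, Function.Embedding.coeFn_mk,
      Prod.mk.injEq]
    constructor
    · rintro ⟨⟨-, hi⟩, hl⟩
      subst hl
      exact ⟨i, hi, rfl, rfl⟩
    · rintro ⟨i', hi', hl, hi⟩
      subst hl; subst hi
      exact ⟨⟨p.1.2, hi'⟩, rfl⟩
  rw [hR, hR', hL, hset, Finset.sum_map]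
  refine Finset.sum_congr rfl fun i _ => ?_
  simp only [hg, Function.Embedding.coeFn_mk, ↓reduceIte]
  ring

/-- **The Gram rank is intrinsic**: `rank(𝕌ᵀ S_{l₀}⁻¹ 𝕌) = rank(Wᵀ S_{l₀}⁻¹ W)` — the rank of the block Gram matrix
`[S_k S_{l₀}⁻¹ S_l]_{k,l≠l₀}` of the raw letter columns. [folklore] -/
theorem rank_gram_eq_rank_blockGram : (𝔾).rank = (𝒢[S, l₀]).rank := by
  classical
  apply le_antisymm
  · -- `𝔾 = Mᵀ 𝒢 M`
    set M := Matrix.of (fun (p : {l : Fin K // l ≠ l₀} × Fin m) (t : 𝕋) =>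
      if p.1.1 = t.1.1 then ⇑((hS t.1.1).eigenvectorBasis t.1.2) p.2 / (hS t.1.1).eigenvalues t.1.2 else 0) with hM
    have hU : (𝕌) = 𝕎[S, l₀] * M := eigenCols_eq_blockCols_mul S hS l₀
    have hG : (𝔾) = Mᵀ * (𝒢[S, l₀] * M) := by
      rw [hU, Matrix.transpose_mul]
      simp only [Matrix.mul_assoc]
    rw [hG]
    exact (Matrix.rank_mul_le_right _ _).trans (Matrix.rank_mul_le_left _ _)
  · -- `𝒢 = Nᵀ 𝔾 N`
    set N := Matrix.of (fun (t : 𝕋) (p : {l : Fin K // l ≠ l₀} × Fin m) =>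
      if t.1.1 = p.1.1 then (hS t.1.1).eigenvalues t.1.2 * ⇑((hS t.1.1).eigenvectorBasis t.1.2) p.2 else 0) with hN
    have hW : 𝕎[S, l₀] = (𝕌) * N := blockCols_eq_eigenCols_mul S hS l₀
    have hG : 𝒢[S, l₀] = Nᵀ * ((𝔾) * N) := by
      rw [hW, Matrix.transpose_mul]
      simp only [Matrix.mul_assoc]
    rw [hG]
    exact (Matrix.rank_mul_le_right _ _).trans (Matrix.rank_mul_le_left _ _)

/-! ## §2  Reflection keeps the Gram rank -/

/-- **Reflection invariance**: the block Gram matrix of the reflected pencil `S_l ↦ (−1)^{d_l} S_l` has the same rank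
(`W ↦ W·diag(±1)`, `S_{l₀}⁻¹ ↦ ±S_{l₀}⁻¹`). [folklore] -/
theorem rank_blockGram_reflect (hS₀ : IsUnit (S l₀).det) :
    (𝒢[(fun l => ((-1 : ℝ) ^ d l) • S l), l₀]).rank = (𝒢[S, l₀]).rank := by
  classical
  set D : Matrix ({l : Fin K // l ≠ l₀} × Fin m) ({l : Fin K // l ≠ l₀} × Fin m) ℝ :=
    Matrix.diagonal (fun p => (-1 : ℝ) ^ d p.1.1) with hD
  have hW : 𝕎[(fun l => ((-1 : ℝ) ^ d l) • S l), l₀] = 𝕎[S, l₀] * D := by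
    refine Matrix.ext fun a p => ?_
    rw [hD, Matrix.mul_diagonal]
    simp only [Matrix.of_apply, Matrix.smul_apply, smul_eq_mul]
    ring
  have hinv : (((-1 : ℝ) ^ d l₀) • S l₀)⁻¹ = ((-1 : ℝ) ^ d l₀) • (S l₀)⁻¹ := inv_reflect hS₀ (d l₀)
  have hDdet : IsUnit D.det := by
    rw [hD, Matrix.det_diagonal, isUnit_iff_ne_zero]
    exact Finset.prod_ne_zero_iff.2 fun p _ => pow_ne_zero _ (by norm_num)
  have hc : IsUnit (Matrix.diagonal (fun _ : ({l : Fin K // l ≠ l₀} × Fin m) => (-1 : ℝ) ^ d l₀)).det := by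
    rw [Matrix.det_diagonal, isUnit_iff_ne_zero]
    exact Finset.prod_ne_zero_iff.2 fun p _ => pow_ne_zero _ (by norm_num)
  have hG : 𝒢[(fun l => ((-1 : ℝ) ^ d l) • S l), l₀]
      = Matrix.diagonal (fun _ : ({l : Fin K // l ≠ l₀} × Fin m) => (-1 : ℝ) ^ d l₀) * (Dᵀ * (𝒢[S, l₀] * D)) := by
    rw [hW]
    simp only [hinv, Matrix.transpose_mul, Matrix.mul_smul, Matrix.smul_mul, Matrix.mul_assoc]
    rw [Matrix.smul_eq_diagonal_mul]
  rw [hG, Matrix.rank_mul_eq_right_of_isUnit_det _ _ hc,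
    Matrix.rank_mul_eq_right_of_isUnit_det _ _ (by rwa [Matrix.det_transpose]),
    Matrix.rank_mul_eq_left_of_isUnit_det _ _ hDdet]

/-! ## §3  All real zeros through the effective format -/

include hS in
/-- **Positive zeros, intrinsic form**: `rank [S_k S_{l₀}⁻¹ S_l]_{k,l≠l₀} ≤ r` ⇒ `Z₊ + 1 ≤ C(r + K − 1, r)`, every size.
[folklore] -/
theorem card_posRoots_pencil_le_of_blockGramRank_le (hS₀ : IsUnit (S l₀).det) (r : ℕ) (hr : (𝒢[S, l₀]).rank ≤ r) :
    ((Matrix.det (∑ l, ((Polynomial.X : Polynomial ℝ) ^ d l) • (S l).map Polynomial.C)).roots.toFinset.filter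
        (fun t => 0 < t)).card + 1 ≤ Nat.choose (r + K - 1) r :=
  card_posRoots_pencil_le_choose_of_gramRank_le d S hS l₀ hS₀ r ((rank_gram_eq_rank_blockGram S hS l₀).le.trans hr)

include hS in
/-- Over `ℝ`: the reflected letters are hermitian. [folklore] -/
theorem isHermitian_reflect (n : ℕ) (l : Fin K) : ((((-1 : ℝ) ^ n) • S l)).IsHermitian := by
  unfold Matrix.IsHermitian
  rw [Matrix.conjTranspose_smul, (hS l).eq, star_trivial]

/-- **ALL REAL ZEROS on the Gram-rank sector** (symmetric letters, stated with `IsSymm` as in the crux): Gram rank `≤ r`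
⇒ `Z + 1 ≤ 2·C(r + K − 1, r)`, at every size `m`. [folklore] -/
theorem card_roots_pencil_le_of_gramRank_le (hSs : ∀ l, (S l).IsSymm) (hS₀ : IsUnit (S l₀).det) (r : ℕ)
    (hr : (𝒢[S, l₀]).rank ≤ r) :
    (Matrix.det (∑ l, ((Polynomial.X : Polynomial ℝ) ^ d l) • (S l).map Polynomial.C)).roots.toFinset.card + 1
      ≤ 2 * Nat.choose (r + K - 1) r := by
  have hH : ∀ l, (S l).IsHermitian := fun l => isHermitian_of_isSymm_real (hSs l)
  have hH' : ∀ l, (((-1 : ℝ) ^ d l) • S l).IsHermitian := fun l => isHermitian_reflect S hH (d l) l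
  have h1 := card_posRoots_pencil_le_of_blockGramRank_le d S hH l₀ hS₀ r hr
  have h2 := card_posRoots_pencil_le_of_blockGramRank_le d (fun l => ((-1 : ℝ) ^ d l) • S l) hH' l₀
    (isUnit_det_reflect hS₀ (d l₀)) r (by rw [rank_blockGram_reflect d S l₀ hS₀]; exact hr)
  have h3 := stub_negRoots K m d S
  omega

/-! ## §4  The crux inequality on the Gram-rank sector, at every size -/

/-- **THE CRUX INEQUALITY ON THE GRAM-RANK SECTOR.**  `q, K ≥ 1`, ANY size `m`, any exponents, real symmetric letters with
a non-degenerate `S_{l₀}` whose (block) Gram rank is `≤ r` with `(12(r + K))^q ≤ K^{q+1}`: the number `Z` of distinct real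
zeros of `det(Σ_l X^{d_l} S_l)` satisfies `Z^q ≤ 2^{K⌊log₂K⌋}`.  (Descartes at the effective format `(r, K)`; the size `m`
does not enter.) [folklore] -/
theorem gramRank_mdr (q : ℕ) (hq : 0 < q) (hSs : ∀ l, (S l).IsSymm) (hS₀ : IsUnit (S l₀).det) (r : ℕ)
    (hr : (𝒢[S, l₀]).rank ≤ r) (hrK : (12 * (r + K)) ^ q ≤ K ^ (q + 1)) :
    (Matrix.det (∑ l, ((Polynomial.X : Polynomial ℝ) ^ d l) • (S l).map Polynomial.C)).roots.toFinset.card ^ q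
      ≤ 2 ^ (K * Nat.log 2 K) := by
  have hK : 0 < K := Fin.pos l₀
  have hZ := card_roots_pencil_le_of_gramRank_le d S l₀ hSs hS₀ r hr
  have hch : Nat.choose (r + K - 1) r ≤ Nat.choose (r + K) K :=
    calc Nat.choose (r + K - 1) r ≤ Nat.choose (r + K) r := Nat.choose_le_choose r (Nat.sub_le _ _)
      _ = Nat.choose (r + K) K := Nat.choose_symm_add
  exact Census.descartesSector_arith q K (r + K) (Nat.choose (r + K) K) _ hq hK (by omega)
    (Census.pow_self_mul_choose_le r K) hrK

/-- **Linear Gram rank, every size**: for all `a, q` and all `K ≥ max 1 (12(a+1))^q`, every real symmetric pencil — of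
ANY size `m` — with a non-degenerate letter `S_{l₀}` and (block) Gram rank `≤ a·K` satisfies `Z^q ≤ 2^{K⌊log₂K⌋}`: the
quantifier shape of `MatrixDescartes` on the format family «one non-degenerate letter, Gram rank `O(K)`», without the
size hypothesis. [folklore] -/
theorem gramRank_linear_mdr (a q : ℕ) (hq : 0 < q) :
    ∀ K m : ℕ, max 1 ((12 * (a + 1)) ^ q) ≤ K →
      ∀ (d : Fin K → ℕ) (S : Fin K → Matrix (Fin m) (Fin m) ℝ), (∀ l, (S l).IsSymm) →
      ∀ l₀ : Fin K, IsUnit (S l₀).det → (𝒢[S, l₀]).rank ≤ a * K →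
      (Matrix.det (∑ l, ((Polynomial.X : Polynomial ℝ) ^ d l) • (S l).map Polynomial.C)).roots.toFinset.card ^ q
        ≤ 2 ^ (K * Nat.log 2 K) := by
  intro K m hK d S hS l₀ hS₀ hr
  have hK2 : (12 * (a + 1)) ^ q ≤ K := le_of_max_le_right hK
  refine gramRank_mdr d S l₀ q hq hS hS₀ (a * K) hr ?_
  have hmK : 12 * (a * K + K) ≤ 12 * (a + 1) * K := by nlinarith
  calc (12 * (a * K + K)) ^ q ≤ (12 * (a + 1) * K) ^ q := Nat.pow_le_pow_left hmK q
    _ = (12 * (a + 1)) ^ q * K ^ q := mul_pow _ _ _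
    _ ≤ K * K ^ q := Nat.mul_le_mul_right _ hK2
    _ = K ^ (q + 1) := (pow_succ' K q).symm

end RankMDR

end GramDual

end Summit.ValiantsHypothesis.ValiantsHypothesis.Theorems.LacunarySymmetroidMatrixDescartes
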